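/-
Copyright (c) 2026. All rights reserved.
Released under Apache 2.0 license as described in the file LICENSE.
Authors: abc-iut cell, prover seat abc-iut-w5-d241 (wave 5, gen 9).
-/
import Summits.ABC.IUTFork.Cor312PilotIdelesPrArchThreshold
import Summits.ABC.IUTFork.Cor312ProvKIdeles
import HarnessLib

/-!
# The fourth corner at GENUINE `K`-level data: the live (non-vacuous) small-height form

Proof-only sequel (no definitions) of `Cor312PilotIdelesPrArchThreshold.lean` (abc-iut-w5-d241; at the print-normalised setting
with abc-iut-w5-d163's honest archimedean container, `GlobalVolumeTransport ↔ deĝ̲(𝔮) ≤ c(l)·log π`; small height + `2l ∣ ord_v(q_v)`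
⇒ ∃ realising ideles with `ThetaFinite ∧ BridgeHyps ∧ AbsLogQPos ∧ GlobalVolumeTransport ∧ Statement`).

**CAVEAT recorded (RQ7 second read abc-iut-w6-d076 on p436354; class C-cert-3-F1 / C-lead ruling C-R16).** The three theorems of
that file which pair `hD : Cor312Prov.IsPilotDataOf D X` (the `F`-level pilot datum OF a collection of initial Θ-data) with
`q`-ideles over `F` REALISING `P_q` — `globalVolumeTransport_settingPrVolArchSharp_iff_logq`, `statement_settingPrVolArchSharp_of_logq_le`,
`exists_ideles_isSettingOf_statement_settingPrVolArchSharp` (there via `hdiv`) — are VACUOUS AS TYPED: at `F`-level genuine data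
[IUTchI] Def. 3.1 (c) forces `l ∤ ord_v(q_v)` while realising forces `2l ∣ ord_v(q_v)`
(`Conditional.SideVacuity.not_realising_qIdeles_of_isPilotDataOf`, p432420). Kernel-true, harmless, but not statements with instances;
the `X`-generic theorems are unaffected. THIS FILE gives the LIVE genuine reading at the `K`-level pilot datum `pilotDataOfK D K` of
abc-iut-c312-4 (`Cor312ProvK` / `Cor312ProvKIdeles`): over `K = F(E_F[l])` the divisibility `2l ∣ ord_w(q_w)` is the THEOREM
`twoMulLDvdOrdq_pilotDataOfK`, realising ideles EXIST, and `deĝ̲_K(𝔮_K) = log(q)`: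

* `ndeg_qDivisor_pilotDataOfK_eq_logq` — `deĝ̲_K(𝔮_K) = log(q)` for `X_K := pilotDataOfK D K`;
* **`exists_ideles_statement_settingPrVolArchSharp_pilotDataOfK`** — for EVERY `D` with `(l+4)(l−3)·log(q) ≤ 6l(l+5)·log π` and every
  choice of the free context binders over `X_K`, ∃ realising Θ- and q-ideles over `K` with
  `ThetaFinite ∧ BridgeHyps ∧ AbsLogQPos ∧ GlobalVolumeTransport ∧ Statement` at the fourth corner — non-vacuous as typed
  (modulo inhabitation of `InitialThetaData` itself; the `K`-level provenance structure of C-cert-3's v5 is not used here).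

HONEST FRAMING: a census datum about the archimedean MODEL container at small height; no side taken on [IUTchIII] Cor. 3.12;
nothing here asserts abc. typed ≠ proved; instantiated ≠ endorsed.
-/

noncomputable section

open Set Function NumberField IsDedekindDomain
open scoped Pointwise

namespace Summit.ABC

namespace IUTFork

namespace Thm311

namespace Real

open Cor312 Cor312Vol Literature.IUT.LogThetaLattice Literature.IUT.LogVolume

variable {F : Type} [Field F] [NumberField F]

/-- Plumbing: `deĝ̲(P_q) = deĝ̲(𝔮)/(2l)` (`P_q = (1/2l)·𝔮`). [cite: DupuyHilado2025, §3.3] -/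
private theorem ndeg_qPilot_eq_ndeg_qDivisor_div {L : Type} [Field L] [NumberField L] (Y : PilotData L) :
    FinDivisor.ndeg L Y.qPilot = FinDivisor.ndeg L Y.qDivisor / (2 * Y.l) := by
  rw [Y.qPilot_eq_smul, map_smul, smul_eq_mul]
  ring

/-- **`deĝ̲_K(𝔮_K) = log(q)`** for the `K`-level pilot datum OF `D` (abc-iut-c312-4's `absLogq_eq_ndeg_qPilot_pilotDataOfK`:
`(1/2l)·log(q) = deĝ̲_K(P_q)`, and `P_q = (1/2l)·𝔮`). [cite: Mochizuki2012, IUTchIV Thm. 1.10 p. 23] [cite: DupuyHilado2025, §3.3] -/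
theorem ndeg_qDivisor_pilotDataOfK_eq_logq
    {K Fbar : Type} [Field K] [NumberField K] [Algebra F K] [Field Fbar] [Algebra F Fbar] [Algebra K Fbar]
    {E : WeierstrassCurve F} [E.IsElliptic] {l : ℕ} {Pb : Literature.IUT.HodgeTheaters.BadPlacePredicates K}
    (D : Literature.IUT.HodgeTheaters.InitialThetaData F K Fbar E l Pb) :
    FinDivisor.ndeg K (Cor312Prov.pilotDataOfK D K).qDivisor = Cor312Prov.logq D := by
  have h := Cor312Prov.absLogq_eq_ndeg_qPilot_pilotDataOfK D K
  rw [ndeg_qPilot_eq_ndeg_qDivisor_div, Cor312Prov.pilotDataOfK_l] at h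
  unfold Cor312Prov.absLogq at h
  have hl : (2 * (l : ℝ)) ≠ 0 := by
    have h5 : (5 : ℝ) ≤ l := by exact_mod_cast D.five_le_l
    have : (0 : ℝ) < 2 * (l : ℝ) := by linarith
    exact this.ne'
  exact ((div_left_inj' hl).mp h).symm

/-- **LIVE GENUINE FORM (`K`-level).** For EVERY collection of initial Θ-data `D` with SMALL height
`(l+4)(l−3)·log(q) ≤ 6l(l+5)·log π`, over the `K`-level pilot datum `X_K := pilotDataOfK D K` (realising ideles over `K` EXIST —
abc-iut-c312-4's `twoMulLDvdOrdq_pilotDataOfK`, the `K`-level repair of C-cert-3-F1) and for every choice of the free context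
binders, there are realising Θ- and `q`-ideles at which, at the fourth corner,
`ThetaFinite ∧ BridgeHyps ∧ AbsLogQPos ∧ GlobalVolumeTransport ∧ Statement` hold — NOT vacuous as typed (modulo inhabitation of
`InitialThetaData` itself). [claim: Mochizuki2012, status: disputed] for the quoted setting;
[cite: DupuyHilado2025, §3.3, §3.4, Thm. 3.10.1]; [cite: Mochizuki2012, IUTchI Ex. 3.2 (iv) p. 71] -/
theorem exists_ideles_statement_settingPrVolArchSharp_pilotDataOfK
    {K Fbar : Type} [Field K] [NumberField K] [Algebra F K] [Field Fbar] [Algebra F Fbar] [Algebra K Fbar]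
    {E : WeierstrassCurve F} [E.IsElliptic] {l : ℕ} {Pb : Literature.IUT.HodgeTheaters.BadPlacePredicates K}
    (D : Literature.IUT.HodgeTheaters.InitialThetaData F K Fbar E l Pb)
    {logvK : PadicLogs K} (hlogK : LogvAnalytic logvK) (hcK : ∀ w : InfinitePlace K, w.IsComplex)
    (M' : Type) [Field M'] [NumberField M']
    (archPk' : ∀ (j : (thetaIndex (Cor312Prov.pilotDataOfK D K)).Label) (vQ : (thetaIndex (Cor312Prov.pilotDataOfK D K)).VQ),
      Set ((logShellsDH (Cor312Prov.pilotDataOfK D K) logvK).Packet j vQ))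
    (archSub' : ∀ (j : (thetaIndex (Cor312Prov.pilotDataOfK D K)).Label) (v : (thetaIndex (Cor312Prov.pilotDataOfK D K)).V),
      Set ((logShellsDH (Cor312Prov.pilotDataOfK D K) logvK).Packet j ((thetaIndex (Cor312Prov.pilotDataOfK D K)).over v)))
    (Ψ' : ℤ → ∀ v : (thetaIndex (Cor312Prov.pilotDataOfK D K)).V, v ∈ (thetaIndex (Cor312Prov.pilotDataOfK D K)).Vbad →
      Set ((logShellsDH (Cor312Prov.pilotDataOfK D K) logvK).StarPacket v))
    (act' : ℤ → ∀ v : (thetaIndex (Cor312Prov.pilotDataOfK D K)).V, v ∈ (thetaIndex (Cor312Prov.pilotDataOfK D K)).Vbad →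
      (logShellsDH (Cor312Prov.pilotDataOfK D K) logvK).StarPacket v → Module.End ℚ ((logShellsDH (Cor312Prov.pilotDataOfK D K) logvK).StarPacket v))
    (Mmod' : ℤ → ∀ j : (thetaIndex (Cor312Prov.pilotDataOfK D K)).LabelStar, Set ((logShellsDH (Cor312Prov.pilotDataOfK D K) logvK).GlobalPacket j.1))
    (region' : ℤ → ∀ j : (thetaIndex (Cor312Prov.pilotDataOfK D K)).LabelStar, FinDivisor M' → ∀ vQ : (thetaIndex (Cor312Prov.pilotDataOfK D K)).VQ,
      Set ((logShellsDH (Cor312Prov.pilotDataOfK D K) logvK).Packet j.1 vQ))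
    (n' : ℤ) {HT' : Type} {LogLink' : HT' → HT' → Type} {IsFull' : ∀ {s t : HT'}, LogLink' s t → Prop}
    (lat' : LGPGaussianLogThetaLattice LogLink' IsFull')
    {Frd' : Type} {IsoF' : Frd' → Frd' → Type} {Ob' : Frd' → Type} {realify' : Frd' → Frd'} {Strip' : Type}
    {IsoS' : Strip' → Strip' → Type} {Mv' : ∀ v : (thetaIndex (Cor312Prov.pilotDataOfK D K)).V, v ∈ (thetaIndex (Cor312Prov.pilotDataOfK D K)).Vbad → Type}
    [∀ v h, Monoid (Mv' v h)]
    (sig' : GlobalLGPFrobenioidSignature (thetaIndex (Cor312Prov.pilotDataOfK D K)).lstar (thetaIndex (Cor312Prov.pilotDataOfK D K)).V (· ∈ (thetaIndex (Cor312Prov.pilotDataOfK D K)).Vbad)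
      Frd' IsoF' Ob' realify' Strip' IsoS' Mv')
    (split' : SplittingMonoids Mv') {ObΔ' : Type} {N' : ∀ v : (thetaIndex (Cor312Prov.pilotDataOfK D K)).V, v ∈ (thetaIndex (Cor312Prov.pilotDataOfK D K)).Vbad → Type}
    [∀ v h, Monoid (N' v h)] (qData' : QPilotData ObΔ' N')
    (hq : ((l : ℝ) + 4) * (l - 3) * Cor312Prov.logq D ≤ 6 * l * (l + 5) * Real.log Real.pi) :
    ∃ (t' : ∀ (pp : Nat.Primes) (_ : Fin (Cor312Prov.pilotDataOfK D K).lstar) (x : (thetaIndex (Cor312Prov.pilotDataOfK D K)).Fibre (.inr pp)),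
          haveI : Fact (pp : ℕ).Prime := ⟨pp.2⟩; kOf (Cor312Prov.pilotDataOfK D K) pp.1 x)
      (tq' : ∀ (pp : Nat.Primes) (x : (thetaIndex (Cor312Prov.pilotDataOfK D K)).Fibre (.inr pp)),
          haveI : Fact (pp : ℕ).Prime := ⟨pp.2⟩; kOf (Cor312Prov.pilotDataOfK D K) pp.1 x)
      (_ : ∀ pp i x, t' pp i x ≠ 0)
      (_ : ∀ (pp : Nat.Primes) (i : Fin (Cor312Prov.pilotDataOfK D K).lstar) (x : (thetaIndex (Cor312Prov.pilotDataOfK D K)).Fibre (.inr pp)),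
          haveI : Fact (pp : ℕ).Prime := ⟨pp.2⟩
          Real.log ‖t' pp i x‖ = -((Cor312Prov.pilotDataOfK D K).thetaPilot i (placeOf (Cor312Prov.pilotDataOfK D K) pp.1 x)) * logNorm K (placeOf (Cor312Prov.pilotDataOfK D K) pp.1 x) /
            localDegree K (placeOf (Cor312Prov.pilotDataOfK D K) pp.1 x))
      (htq0' : ∀ pp x, tq' pp x ≠ 0)
      (htq1' : ∀ (pp : Nat.Primes) (x : (thetaIndex (Cor312Prov.pilotDataOfK D K)).Fibre (.inr pp)),
          haveI : Fact (pp : ℕ).Prime := ⟨pp.2⟩; placeOf (Cor312Prov.pilotDataOfK D K) pp.1 x ∉ (Cor312Prov.pilotDataOfK D K).S → ‖tq' pp x‖ = 1)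
      (_ : ∀ (pp : Nat.Primes) (x : (thetaIndex (Cor312Prov.pilotDataOfK D K)).Fibre (.inr pp)),
          haveI : Fact (pp : ℕ).Prime := ⟨pp.2⟩
          Real.log ‖tq' pp x‖ = -((Cor312Prov.pilotDataOfK D K).qPilot (placeOf (Cor312Prov.pilotDataOfK D K) pp.1 x)) * logNorm K (placeOf (Cor312Prov.pilotDataOfK D K) pp.1 x) /
            localDegree K (placeOf (Cor312Prov.pilotDataOfK D K) pp.1 x)),
      (settingPrVolArchSharp (Cor312Prov.pilotDataOfK D K) hlogK hcK M' archPk' archSub' Ψ' act' Mmod' region' n' lat' sig' split' qData'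
          t' tq' htq0' htq1').ThetaFinite ∧
      BridgeHyps (settingPrVolArchSharp (Cor312Prov.pilotDataOfK D K) hlogK hcK M' archPk' archSub' Ψ' act' Mmod' region' n' lat' sig' split' qData'
          t' tq' htq0' htq1') ∧
      (settingPrVolArchSharp (Cor312Prov.pilotDataOfK D K) hlogK hcK M' archPk' archSub' Ψ' act' Mmod' region' n' lat' sig' split' qData'
          t' tq' htq0' htq1').AbsLogQPos ∧
      GlobalVolumeTransport (settingPrVolArchSharp (Cor312Prov.pilotDataOfK D K) hlogK hcK M' archPk' archSub' Ψ' act' Mmod' region' n' lat' sig'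
          split' qData' t' tq' htq0' htq1') ∧
      (settingPrVolArchSharp (Cor312Prov.pilotDataOfK D K) hlogK hcK M' archPk' archSub' Ψ' act' Mmod' region' n' lat' sig' split' qData'
          t' tq' htq0' htq1').Statement := by
  refine exists_ideles_statement_settingPrVolArchSharp (Cor312Prov.pilotDataOfK D K) hlogK hcK M' archPk' archSub' Ψ' act' Mmod' region' n'
    lat' sig' split' qData' (Cor312Prov.twoMulLDvdOrdq_pilotDataOfK D) ?_
  rw [ndeg_qDivisor_pilotDataOfK_eq_logq D, Cor312Prov.pilotDataOfK_l]
  have h5 : (5 : ℝ) ≤ l := by exact_mod_cast D.five_le_l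
  have hpos : (0 : ℝ) < ((l : ℝ) + 4) * (l - 3) := by nlinarith
  rw [div_mul_eq_mul_div, le_div_iff₀ hpos]
  linarith


/-! ## Appendix (v2). The LIVE `K`-level twins of the threshold and of the large-height closure of Team B's route -/

/-- **LIVE GENUINE THRESHOLD (`K`-level):** for any realising ideles over `K` at `X_K := pilotDataOfK D K`, at the fourth corner
`GlobalVolumeTransport ↔ (l+4)(l−3)·log(q) ≤ 6l(l+5)·log π` — the non-vacuous twin of the `F`-level
`globalVolumeTransport_settingPrVolArchSharp_iff_logq`. [claim: Mochizuki2012, status: disputed] for the quoted setting;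
[cite: DupuyHilado2025, §3.3, Thm. 3.10.1]; [cite: Mochizuki2012, IUTchIV Thm. 1.10 p. 23] -/
theorem globalVolumeTransport_settingPrVolArchSharp_pilotDataOfK_iff
    {K Fbar : Type} [Field K] [NumberField K] [Algebra F K] [Field Fbar] [Algebra F Fbar] [Algebra K Fbar]
    {E : WeierstrassCurve F} [E.IsElliptic] {l : ℕ} {Pb : Literature.IUT.HodgeTheaters.BadPlacePredicates K}
    (D : Literature.IUT.HodgeTheaters.InitialThetaData F K Fbar E l Pb)
    {logvK : PadicLogs K} (hlogK : LogvAnalytic logvK) (hcK : ∀ w : InfinitePlace K, w.IsComplex)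
    (M' : Type) [Field M'] [NumberField M']
    (archPk' : ∀ (j : (thetaIndex (Cor312Prov.pilotDataOfK D K)).Label) (vQ : (thetaIndex (Cor312Prov.pilotDataOfK D K)).VQ),
      Set ((logShellsDH (Cor312Prov.pilotDataOfK D K) logvK).Packet j vQ))
    (archSub' : ∀ (j : (thetaIndex (Cor312Prov.pilotDataOfK D K)).Label) (v : (thetaIndex (Cor312Prov.pilotDataOfK D K)).V),
      Set ((logShellsDH (Cor312Prov.pilotDataOfK D K) logvK).Packet j ((thetaIndex (Cor312Prov.pilotDataOfK D K)).over v)))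
    (Ψ' : ℤ → ∀ v : (thetaIndex (Cor312Prov.pilotDataOfK D K)).V, v ∈ (thetaIndex (Cor312Prov.pilotDataOfK D K)).Vbad →
      Set ((logShellsDH (Cor312Prov.pilotDataOfK D K) logvK).StarPacket v))
    (act' : ℤ → ∀ v : (thetaIndex (Cor312Prov.pilotDataOfK D K)).V, v ∈ (thetaIndex (Cor312Prov.pilotDataOfK D K)).Vbad →
      (logShellsDH (Cor312Prov.pilotDataOfK D K) logvK).StarPacket v → Module.End ℚ ((logShellsDH (Cor312Prov.pilotDataOfK D K) logvK).StarPacket v))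
    (Mmod' : ℤ → ∀ j : (thetaIndex (Cor312Prov.pilotDataOfK D K)).LabelStar, Set ((logShellsDH (Cor312Prov.pilotDataOfK D K) logvK).GlobalPacket j.1))
    (region' : ℤ → ∀ j : (thetaIndex (Cor312Prov.pilotDataOfK D K)).LabelStar, FinDivisor M' → ∀ vQ : (thetaIndex (Cor312Prov.pilotDataOfK D K)).VQ,
      Set ((logShellsDH (Cor312Prov.pilotDataOfK D K) logvK).Packet j.1 vQ))
    (n' : ℤ) {HT' : Type} {LogLink' : HT' → HT' → Type} {IsFull' : ∀ {s t : HT'}, LogLink' s t → Prop}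
    (lat' : LGPGaussianLogThetaLattice LogLink' IsFull')
    {Frd' : Type} {IsoF' : Frd' → Frd' → Type} {Ob' : Frd' → Type} {realify' : Frd' → Frd'} {Strip' : Type}
    {IsoS' : Strip' → Strip' → Type} {Mv' : ∀ v : (thetaIndex (Cor312Prov.pilotDataOfK D K)).V, v ∈ (thetaIndex (Cor312Prov.pilotDataOfK D K)).Vbad → Type}
    [∀ v h, Monoid (Mv' v h)]
    (sig' : GlobalLGPFrobenioidSignature (thetaIndex (Cor312Prov.pilotDataOfK D K)).lstar (thetaIndex (Cor312Prov.pilotDataOfK D K)).V (· ∈ (thetaIndex (Cor312Prov.pilotDataOfK D K)).Vbad)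
      Frd' IsoF' Ob' realify' Strip' IsoS' Mv')
    (split' : SplittingMonoids Mv') {ObΔ' : Type} {N' : ∀ v : (thetaIndex (Cor312Prov.pilotDataOfK D K)).V, v ∈ (thetaIndex (Cor312Prov.pilotDataOfK D K)).Vbad → Type}
    [∀ v h, Monoid (N' v h)] (qData' : QPilotData ObΔ' N')
    (t' : ∀ (pp : Nat.Primes) (_ : Fin (Cor312Prov.pilotDataOfK D K).lstar) (x : (thetaIndex (Cor312Prov.pilotDataOfK D K)).Fibre (.inr pp)),
      haveI : Fact (pp : ℕ).Prime := ⟨pp.2⟩; kOf (Cor312Prov.pilotDataOfK D K) pp.1 x)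
    (tq' : ∀ (pp : Nat.Primes) (x : (thetaIndex (Cor312Prov.pilotDataOfK D K)).Fibre (.inr pp)),
      haveI : Fact (pp : ℕ).Prime := ⟨pp.2⟩; kOf (Cor312Prov.pilotDataOfK D K) pp.1 x)
    (ht0' : ∀ pp i x, t' pp i x ≠ 0)
    (ht' : ∀ (pp : Nat.Primes) (i : Fin (Cor312Prov.pilotDataOfK D K).lstar) (x : (thetaIndex (Cor312Prov.pilotDataOfK D K)).Fibre (.inr pp)),
      haveI : Fact (pp : ℕ).Prime := ⟨pp.2⟩
      Real.log ‖t' pp i x‖ = -((Cor312Prov.pilotDataOfK D K).thetaPilot i (placeOf (Cor312Prov.pilotDataOfK D K) pp.1 x)) * logNorm K (placeOf (Cor312Prov.pilotDataOfK D K) pp.1 x) /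
        localDegree K (placeOf (Cor312Prov.pilotDataOfK D K) pp.1 x))
    (htq0' : ∀ pp x, tq' pp x ≠ 0)
    (htq1' : ∀ (pp : Nat.Primes) (x : (thetaIndex (Cor312Prov.pilotDataOfK D K)).Fibre (.inr pp)),
      haveI : Fact (pp : ℕ).Prime := ⟨pp.2⟩; placeOf (Cor312Prov.pilotDataOfK D K) pp.1 x ∉ (Cor312Prov.pilotDataOfK D K).S → ‖tq' pp x‖ = 1)
    (htq' : ∀ (pp : Nat.Primes) (x : (thetaIndex (Cor312Prov.pilotDataOfK D K)).Fibre (.inr pp)),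
      haveI : Fact (pp : ℕ).Prime := ⟨pp.2⟩
      Real.log ‖tq' pp x‖ = -((Cor312Prov.pilotDataOfK D K).qPilot (placeOf (Cor312Prov.pilotDataOfK D K) pp.1 x)) * logNorm K (placeOf (Cor312Prov.pilotDataOfK D K) pp.1 x) /
        localDegree K (placeOf (Cor312Prov.pilotDataOfK D K) pp.1 x)) :
    GlobalVolumeTransport (settingPrVolArchSharp (Cor312Prov.pilotDataOfK D K) hlogK hcK M' archPk' archSub' Ψ' act' Mmod' region' n' lat' sig' split' qData'
          t' tq' htq0' htq1') ↔
      ((l : ℝ) + 4) * (l - 3) * Cor312Prov.logq D ≤ 6 * l * (l + 5) * Real.log Real.pi := by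
  rw [globalVolumeTransport_settingPrVolArchSharp_iff_ndeg_qDivisor_le (Cor312Prov.pilotDataOfK D K) hlogK hcK M' archPk' archSub' Ψ' act' Mmod' region' n'
      lat' sig' split' qData' t' tq' ht0' ht' htq0' htq1' htq',
    ndeg_qDivisor_pilotDataOfK_eq_logq D, Cor312Prov.pilotDataOfK_l]
  have h5 : (5 : ℝ) ≤ l := by exact_mod_cast D.five_le_l
  have hpos : (0 : ℝ) < ((l : ℝ) + 4) * (l - 3) := by nlinarith
  rw [div_mul_eq_mul_div, le_div_iff₀ hpos]
  constructor <;> intro h <;> linarith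

/-- **LARGE HEIGHT ⇒ TEAM B's ROUTE CLOSED at genuine `K`-level data:** if `log(q) > (50/3)·log π` (`≈ 19.08`) then, for ANY realising
ideles over `K`, `¬ GlobalVolumeTransport` at the `K`-level fourth corner — for every initial Θ-datum `D` (its `l ≥ 5`), every choice
of the free context binders. [claim: Mochizuki2012, status: disputed] for the quoted setting; [cite: DupuyHilado2025, §3.3, Thm. 3.10.1] -/
theorem not_globalVolumeTransport_settingPrVolArchSharp_pilotDataOfK_of_lt
    {K Fbar : Type} [Field K] [NumberField K] [Algebra F K] [Field Fbar] [Algebra F Fbar] [Algebra K Fbar]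
    {E : WeierstrassCurve F} [E.IsElliptic] {l : ℕ} {Pb : Literature.IUT.HodgeTheaters.BadPlacePredicates K}
    (D : Literature.IUT.HodgeTheaters.InitialThetaData F K Fbar E l Pb)
    {logvK : PadicLogs K} (hlogK : LogvAnalytic logvK) (hcK : ∀ w : InfinitePlace K, w.IsComplex)
    (M' : Type) [Field M'] [NumberField M']
    (archPk' : ∀ (j : (thetaIndex (Cor312Prov.pilotDataOfK D K)).Label) (vQ : (thetaIndex (Cor312Prov.pilotDataOfK D K)).VQ),
      Set ((logShellsDH (Cor312Prov.pilotDataOfK D K) logvK).Packet j vQ))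
    (archSub' : ∀ (j : (thetaIndex (Cor312Prov.pilotDataOfK D K)).Label) (v : (thetaIndex (Cor312Prov.pilotDataOfK D K)).V),
      Set ((logShellsDH (Cor312Prov.pilotDataOfK D K) logvK).Packet j ((thetaIndex (Cor312Prov.pilotDataOfK D K)).over v)))
    (Ψ' : ℤ → ∀ v : (thetaIndex (Cor312Prov.pilotDataOfK D K)).V, v ∈ (thetaIndex (Cor312Prov.pilotDataOfK D K)).Vbad →
      Set ((logShellsDH (Cor312Prov.pilotDataOfK D K) logvK).StarPacket v))
    (act' : ℤ → ∀ v : (thetaIndex (Cor312Prov.pilotDataOfK D K)).V, v ∈ (thetaIndex (Cor312Prov.pilotDataOfK D K)).Vbad →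
      (logShellsDH (Cor312Prov.pilotDataOfK D K) logvK).StarPacket v → Module.End ℚ ((logShellsDH (Cor312Prov.pilotDataOfK D K) logvK).StarPacket v))
    (Mmod' : ℤ → ∀ j : (thetaIndex (Cor312Prov.pilotDataOfK D K)).LabelStar, Set ((logShellsDH (Cor312Prov.pilotDataOfK D K) logvK).GlobalPacket j.1))
    (region' : ℤ → ∀ j : (thetaIndex (Cor312Prov.pilotDataOfK D K)).LabelStar, FinDivisor M' → ∀ vQ : (thetaIndex (Cor312Prov.pilotDataOfK D K)).VQ,
      Set ((logShellsDH (Cor312Prov.pilotDataOfK D K) logvK).Packet j.1 vQ))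
    (n' : ℤ) {HT' : Type} {LogLink' : HT' → HT' → Type} {IsFull' : ∀ {s t : HT'}, LogLink' s t → Prop}
    (lat' : LGPGaussianLogThetaLattice LogLink' IsFull')
    {Frd' : Type} {IsoF' : Frd' → Frd' → Type} {Ob' : Frd' → Type} {realify' : Frd' → Frd'} {Strip' : Type}
    {IsoS' : Strip' → Strip' → Type} {Mv' : ∀ v : (thetaIndex (Cor312Prov.pilotDataOfK D K)).V, v ∈ (thetaIndex (Cor312Prov.pilotDataOfK D K)).Vbad → Type}
    [∀ v h, Monoid (Mv' v h)]
    (sig' : GlobalLGPFrobenioidSignature (thetaIndex (Cor312Prov.pilotDataOfK D K)).lstar (thetaIndex (Cor312Prov.pilotDataOfK D K)).V (· ∈ (thetaIndex (Cor312Prov.pilotDataOfK D K)).Vbad)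
      Frd' IsoF' Ob' realify' Strip' IsoS' Mv')
    (split' : SplittingMonoids Mv') {ObΔ' : Type} {N' : ∀ v : (thetaIndex (Cor312Prov.pilotDataOfK D K)).V, v ∈ (thetaIndex (Cor312Prov.pilotDataOfK D K)).Vbad → Type}
    [∀ v h, Monoid (N' v h)] (qData' : QPilotData ObΔ' N')
    (t' : ∀ (pp : Nat.Primes) (_ : Fin (Cor312Prov.pilotDataOfK D K).lstar) (x : (thetaIndex (Cor312Prov.pilotDataOfK D K)).Fibre (.inr pp)),
      haveI : Fact (pp : ℕ).Prime := ⟨pp.2⟩; kOf (Cor312Prov.pilotDataOfK D K) pp.1 x)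
    (tq' : ∀ (pp : Nat.Primes) (x : (thetaIndex (Cor312Prov.pilotDataOfK D K)).Fibre (.inr pp)),
      haveI : Fact (pp : ℕ).Prime := ⟨pp.2⟩; kOf (Cor312Prov.pilotDataOfK D K) pp.1 x)
    (ht0' : ∀ pp i x, t' pp i x ≠ 0)
    (ht' : ∀ (pp : Nat.Primes) (i : Fin (Cor312Prov.pilotDataOfK D K).lstar) (x : (thetaIndex (Cor312Prov.pilotDataOfK D K)).Fibre (.inr pp)),
      haveI : Fact (pp : ℕ).Prime := ⟨pp.2⟩
      Real.log ‖t' pp i x‖ = -((Cor312Prov.pilotDataOfK D K).thetaPilot i (placeOf (Cor312Prov.pilotDataOfK D K) pp.1 x)) * logNorm K (placeOf (Cor312Prov.pilotDataOfK D K) pp.1 x) /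
        localDegree K (placeOf (Cor312Prov.pilotDataOfK D K) pp.1 x))
    (htq0' : ∀ pp x, tq' pp x ≠ 0)
    (htq1' : ∀ (pp : Nat.Primes) (x : (thetaIndex (Cor312Prov.pilotDataOfK D K)).Fibre (.inr pp)),
      haveI : Fact (pp : ℕ).Prime := ⟨pp.2⟩; placeOf (Cor312Prov.pilotDataOfK D K) pp.1 x ∉ (Cor312Prov.pilotDataOfK D K).S → ‖tq' pp x‖ = 1)
    (htq' : ∀ (pp : Nat.Primes) (x : (thetaIndex (Cor312Prov.pilotDataOfK D K)).Fibre (.inr pp)),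
      haveI : Fact (pp : ℕ).Prime := ⟨pp.2⟩
      Real.log ‖tq' pp x‖ = -((Cor312Prov.pilotDataOfK D K).qPilot (placeOf (Cor312Prov.pilotDataOfK D K) pp.1 x)) * logNorm K (placeOf (Cor312Prov.pilotDataOfK D K) pp.1 x) /
        localDegree K (placeOf (Cor312Prov.pilotDataOfK D K) pp.1 x))
    (hbig : 50 / 3 * Real.log Real.pi < Cor312Prov.logq D) :
    ¬ GlobalVolumeTransport (settingPrVolArchSharp (Cor312Prov.pilotDataOfK D K) hlogK hcK M' archPk' archSub' Ψ' act' Mmod' region' n' lat' sig' split' qData'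
          t' tq' htq0' htq1') := by
  rw [← ndeg_qDivisor_pilotDataOfK_eq_logq D] at hbig
  exact not_globalVolumeTransport_settingPrVolArchSharp_of_lt (Cor312Prov.pilotDataOfK D K) hlogK hcK M' archPk' archSub' Ψ' act' Mmod' region' n'
      lat' sig' split' qData' t' tq' ht0' ht' htq0' htq1' htq' hbig

/-- **EXISTENCE FORM of the large-height closure (`K`-level, non-vacuous):** for every `D` with `log(q) > (50/3)·log π` there ARE
realising ideles over `K` (abc-iut-c312-4's `exists_realising_thetaIdeles_pilotDataOfK` / `exists_realising_qIdeles_pilotDataOfK`)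
at which `ThetaFinite ∧ BridgeHyps ∧ AbsLogQPos ∧ ¬ GlobalVolumeTransport ∧ (Statement ↔ ↑(−deĝ̲(P_q)) ≤ −|log Θ|)` — Team B's
region-volume input G-c312-11-1 fails there while every side condition holds and the typed Statement is exactly the hull question.
[claim: Mochizuki2012, status: disputed] for the quoted setting; [cite: DupuyHilado2025, §3.3, §3.4, Thm. 3.10.1];
[cite: Mochizuki2012, IUTchI Ex. 3.2 (iv) p. 71] -/
theorem exists_ideles_not_globalVolumeTransport_settingPrVolArchSharp_pilotDataOfK
    {K Fbar : Type} [Field K] [NumberField K] [Algebra F K] [Field Fbar] [Algebra F Fbar] [Algebra K Fbar]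
    {E : WeierstrassCurve F} [E.IsElliptic] {l : ℕ} {Pb : Literature.IUT.HodgeTheaters.BadPlacePredicates K}
    (D : Literature.IUT.HodgeTheaters.InitialThetaData F K Fbar E l Pb)
    {logvK : PadicLogs K} (hlogK : LogvAnalytic logvK) (hcK : ∀ w : InfinitePlace K, w.IsComplex)
    (M' : Type) [Field M'] [NumberField M']
    (archPk' : ∀ (j : (thetaIndex (Cor312Prov.pilotDataOfK D K)).Label) (vQ : (thetaIndex (Cor312Prov.pilotDataOfK D K)).VQ),
      Set ((logShellsDH (Cor312Prov.pilotDataOfK D K) logvK).Packet j vQ))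
    (archSub' : ∀ (j : (thetaIndex (Cor312Prov.pilotDataOfK D K)).Label) (v : (thetaIndex (Cor312Prov.pilotDataOfK D K)).V),
      Set ((logShellsDH (Cor312Prov.pilotDataOfK D K) logvK).Packet j ((thetaIndex (Cor312Prov.pilotDataOfK D K)).over v)))
    (Ψ' : ℤ → ∀ v : (thetaIndex (Cor312Prov.pilotDataOfK D K)).V, v ∈ (thetaIndex (Cor312Prov.pilotDataOfK D K)).Vbad →
      Set ((logShellsDH (Cor312Prov.pilotDataOfK D K) logvK).StarPacket v))
    (act' : ℤ → ∀ v : (thetaIndex (Cor312Prov.pilotDataOfK D K)).V, v ∈ (thetaIndex (Cor312Prov.pilotDataOfK D K)).Vbad →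
      (logShellsDH (Cor312Prov.pilotDataOfK D K) logvK).StarPacket v → Module.End ℚ ((logShellsDH (Cor312Prov.pilotDataOfK D K) logvK).StarPacket v))
    (Mmod' : ℤ → ∀ j : (thetaIndex (Cor312Prov.pilotDataOfK D K)).LabelStar, Set ((logShellsDH (Cor312Prov.pilotDataOfK D K) logvK).GlobalPacket j.1))
    (region' : ℤ → ∀ j : (thetaIndex (Cor312Prov.pilotDataOfK D K)).LabelStar, FinDivisor M' → ∀ vQ : (thetaIndex (Cor312Prov.pilotDataOfK D K)).VQ,
      Set ((logShellsDH (Cor312Prov.pilotDataOfK D K) logvK).Packet j.1 vQ))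
    (n' : ℤ) {HT' : Type} {LogLink' : HT' → HT' → Type} {IsFull' : ∀ {s t : HT'}, LogLink' s t → Prop}
    (lat' : LGPGaussianLogThetaLattice LogLink' IsFull')
    {Frd' : Type} {IsoF' : Frd' → Frd' → Type} {Ob' : Frd' → Type} {realify' : Frd' → Frd'} {Strip' : Type}
    {IsoS' : Strip' → Strip' → Type} {Mv' : ∀ v : (thetaIndex (Cor312Prov.pilotDataOfK D K)).V, v ∈ (thetaIndex (Cor312Prov.pilotDataOfK D K)).Vbad → Type}
    [∀ v h, Monoid (Mv' v h)]
    (sig' : GlobalLGPFrobenioidSignature (thetaIndex (Cor312Prov.pilotDataOfK D K)).lstar (thetaIndex (Cor312Prov.pilotDataOfK D K)).V (· ∈ (thetaIndex (Cor312Prov.pilotDataOfK D K)).Vbad)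
      Frd' IsoF' Ob' realify' Strip' IsoS' Mv')
    (split' : SplittingMonoids Mv') {ObΔ' : Type} {N' : ∀ v : (thetaIndex (Cor312Prov.pilotDataOfK D K)).V, v ∈ (thetaIndex (Cor312Prov.pilotDataOfK D K)).Vbad → Type}
    [∀ v h, Monoid (N' v h)] (qData' : QPilotData ObΔ' N')
    (hbig : 50 / 3 * Real.log Real.pi < Cor312Prov.logq D) :
    ∃ (t' : ∀ (pp : Nat.Primes) (_ : Fin (Cor312Prov.pilotDataOfK D K).lstar) (x : (thetaIndex (Cor312Prov.pilotDataOfK D K)).Fibre (.inr pp)),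
          haveI : Fact (pp : ℕ).Prime := ⟨pp.2⟩; kOf (Cor312Prov.pilotDataOfK D K) pp.1 x)
      (tq' : ∀ (pp : Nat.Primes) (x : (thetaIndex (Cor312Prov.pilotDataOfK D K)).Fibre (.inr pp)),
          haveI : Fact (pp : ℕ).Prime := ⟨pp.2⟩; kOf (Cor312Prov.pilotDataOfK D K) pp.1 x)
      (_ : ∀ pp i x, t' pp i x ≠ 0)
      (_ : ∀ (pp : Nat.Primes) (i : Fin (Cor312Prov.pilotDataOfK D K).lstar) (x : (thetaIndex (Cor312Prov.pilotDataOfK D K)).Fibre (.inr pp)),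
          haveI : Fact (pp : ℕ).Prime := ⟨pp.2⟩
          Real.log ‖t' pp i x‖ = -((Cor312Prov.pilotDataOfK D K).thetaPilot i (placeOf (Cor312Prov.pilotDataOfK D K) pp.1 x)) * logNorm K (placeOf (Cor312Prov.pilotDataOfK D K) pp.1 x) /
            localDegree K (placeOf (Cor312Prov.pilotDataOfK D K) pp.1 x))
      (htq0' : ∀ pp x, tq' pp x ≠ 0)
      (htq1' : ∀ (pp : Nat.Primes) (x : (thetaIndex (Cor312Prov.pilotDataOfK D K)).Fibre (.inr pp)),
          haveI : Fact (pp : ℕ).Prime := ⟨pp.2⟩; placeOf (Cor312Prov.pilotDataOfK D K) pp.1 x ∉ (Cor312Prov.pilotDataOfK D K).S → ‖tq' pp x‖ = 1)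
      (_ : ∀ (pp : Nat.Primes) (x : (thetaIndex (Cor312Prov.pilotDataOfK D K)).Fibre (.inr pp)),
          haveI : Fact (pp : ℕ).Prime := ⟨pp.2⟩
          Real.log ‖tq' pp x‖ = -((Cor312Prov.pilotDataOfK D K).qPilot (placeOf (Cor312Prov.pilotDataOfK D K) pp.1 x)) * logNorm K (placeOf (Cor312Prov.pilotDataOfK D K) pp.1 x) /
            localDegree K (placeOf (Cor312Prov.pilotDataOfK D K) pp.1 x)),
      (settingPrVolArchSharp (Cor312Prov.pilotDataOfK D K) hlogK hcK M' archPk' archSub' Ψ' act' Mmod' region' n' lat' sig' split' qData'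
          t' tq' htq0' htq1').ThetaFinite ∧
      BridgeHyps (settingPrVolArchSharp (Cor312Prov.pilotDataOfK D K) hlogK hcK M' archPk' archSub' Ψ' act' Mmod' region' n' lat' sig' split' qData'
          t' tq' htq0' htq1') ∧
      (settingPrVolArchSharp (Cor312Prov.pilotDataOfK D K) hlogK hcK M' archPk' archSub' Ψ' act' Mmod' region' n' lat' sig' split' qData'
          t' tq' htq0' htq1').AbsLogQPos ∧
      ¬ GlobalVolumeTransport (settingPrVolArchSharp (Cor312Prov.pilotDataOfK D K) hlogK hcK M' archPk' archSub' Ψ' act' Mmod' region' n' lat' sig' split' qData'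
          t' tq' htq0' htq1') ∧
      ((settingPrVolArchSharp (Cor312Prov.pilotDataOfK D K) hlogK hcK M' archPk' archSub' Ψ' act' Mmod' region' n' lat' sig' split' qData'
          t' tq' htq0' htq1').Statement ↔
        (((-FinDivisor.ndeg K (Cor312Prov.pilotDataOfK D K).qPilot : ℝ) : WithTop ℝ) ≤ (settingPrVolArchSharp (Cor312Prov.pilotDataOfK D K) hlogK hcK M' archPk' archSub' Ψ' act' Mmod' region' n' lat' sig' split' qData'
          t' tq' htq0' htq1').negLogTheta)) := by
  obtain ⟨t', ht0', ht1', ht'⟩ := Cor312Prov.exists_realising_thetaIdeles_pilotDataOfK D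
  obtain ⟨tq', htq0', htq1', htq'⟩ := Cor312Prov.exists_realising_qIdeles_pilotDataOfK D
  exact ⟨t', tq', ht0', ht', htq0', htq1', htq',
    thetaFinite_settingPrVolArchSharp (Cor312Prov.pilotDataOfK D K) hlogK hcK M' archPk' archSub' Ψ' act' Mmod' region' n' lat' sig' split'
      qData' t' tq' ht0' ht1' htq0' htq1',
    bridgeHyps_settingPrVolArchSharp_of_ideles (Cor312Prov.pilotDataOfK D K) hlogK hcK M' archPk' archSub' Ψ' act' Mmod' region' n' lat' sig'
      split' qData' t' tq' ht0' ht1' htq0' htq1',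
    absLogQPos_settingPrVolArchSharp (Cor312Prov.pilotDataOfK D K) hlogK hcK M' archPk' archSub' Ψ' act' Mmod' region' n' lat' sig' split'
      qData' t' tq' htq0' htq1' htq',
    not_globalVolumeTransport_settingPrVolArchSharp_pilotDataOfK_of_lt D hlogK hcK M' archPk' archSub' Ψ' act' Mmod' region'
      n' lat' sig' split' qData' t' tq' ht0' ht' htq0' htq1' htq' hbig,
    statement_settingPrVolArchSharp_iff (Cor312Prov.pilotDataOfK D K) hlogK hcK M' archPk' archSub' Ψ' act' Mmod' region' n' lat' sig' split'
      qData' t' tq' htq0' htq1' htq' ht0' ht1'⟩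

end Real

end Thm311

end IUTFork

end Summit.ABC

end
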